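import Summits.ResolutionOfSingularities.ResolutionOfSingularities.Theorems.FrobeniusClosingSteerInsepStepChart
import Literature.AlgebraicGeometry.Resolution.RegularLocalOrder
import Mathlib.RingTheory.Derivation.Basic
import Mathlib.Algebra.Polynomial.Eval.Coeff
import Mathlib.Algebra.CharP.Lemmas
import Mathlib.Algebra.CharP.Subring
import HarnessLib

/-!
# Steer / LEMMA I kernel, file F5a: READING TOOLS — reading in `R̄ = S₁ ⧸ I`, order additivity, derivations on `I²`, Frobenius bookkeeping,
# the polynomial `G_E = Σ (aᵢ + bᵢT) Tⁱ`, exponent bookkeeping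

OURS (campaign res-hironaka, rung L ★L-G4, slot W4.1, crux `Steer` stmt-ResolutionOfSingularities-16345; res-L0-w41-plan-1 RULING 155a, kernel of
res-L0-w41-idea-3's LEMMA I `InsepStepNotIsolated`; res-L0-w41-stub-3 g7, blueprint `KERNEL-BLUEPRINT-LemmaI.md` 693d33707585fe97 §4; replaces the role
of no printed item; NOT a statement of the manuscript under review [claim: Hironaka2017, status: under-review]; AI review is weaker than expert review).
Theses-free, definition-free; generic algebra used by the degree-two and degree-four assemblies.

* `coeff_mem_of_reading` — with the polynomial lemma (PL₁) available in `R̄ = S₁ ⧸ I`: `G(t) ≡ a mod I`, `a ∈ 𝔪₁^N`, `deg G < 2N` ⇒ coefficients of `G` in `𝔪₀`;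
* `mem_pow_of_exc_mul_mem` — order additivity `X ∉ 𝔪², X·a ∈ 𝔪^(k+1) ⇒ a ∈ 𝔪^k` (tree `mul_not_mem_pow_of_not_mem_pow`, Zariski–Samuel);
* `apply_sq_mem_of_forall_mem_span` — a derivation with values in `(X)` maps `I²` into `(X)·I`;
* `sum_sub_sq_sum_eq` — `Σ ι(cᵢ) tⁱ − (Σ ι(sᵢ) t^{i/2})² = Σ ι(cᵢ − sᵢ²) tⁱ` in characteristic `2` (`sᵢ = 0` for odd `i`);
* `eval₂_sum_linear_mul_pow`, `degree_sum_linear_mul_pow_lt` — value and degree of `G_E`;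
* `eq_layer_add_single_two`, `layer_add_single_one` — exponent bookkeeping on `Fin 3`.
[cite: ZariskiSamuel1960, Ch. VIII §1 Thm. 1] [cite: Matsumura1987, Thm. 17.10] [folklore]
-/

noncomputable section

-- single-problem summit: the doubled namespace component `ResolutionOfSingularities` is forced
set_option linter.dupNamespace false

namespace Summit.ResolutionOfSingularities.ResolutionOfSingularities.Theorems.SwitchingDichotomy.LemmaI

open IsLocalRing Literature.AlgebraicGeometry.Resolution

variable {L : Type} [Field L] {S₀ S₁ : Subring L}

/-- **Reading in `R̄ = S₁ ⧸ I`.** With the polynomial lemma available in `R̄` (hypothesis `PL`, i.e. `LemmaI.polyLemma_one` for `ῑ = mk ∘ ι`, `v = t̄`):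
if `G(t) ≡ a mod I` with `a ∈ 𝔪₁^N` and `deg G < 2N`, then all coefficients of `G` lie in `𝔪₀`. [folklore] -/
theorem coeff_mem_of_reading [IsLocalRing S₀] [IsLocalRing S₁] (h : S₀ ≤ S₁) {I : Ideal S₁} [IsLocalRing (S₁ ⧸ I)] (t₁ : S₁)
    (PL : ∀ (N : ℕ) (G : Polynomial S₀), G.degree < (2 * N : ℕ) →
      G.eval₂ ((Ideal.Quotient.mk I).comp (Subring.inclusion h)) (Ideal.Quotient.mk I t₁) ∈ maximalIdeal (S₁ ⧸ I) ^ N →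
        ∀ j, G.coeff j ∈ maximalIdeal S₀)
    {N : ℕ} {G : Polynomial S₀} (hdeg : G.degree < (2 * N : ℕ)) {a : S₁} (ha : a ∈ maximalIdeal S₁ ^ N)
    (hcong : G.eval₂ (Subring.inclusion h) t₁ - a ∈ I) : ∀ j, G.coeff j ∈ maximalIdeal S₀ := by
  refine PL N G hdeg ?_
  rw [← Polynomial.hom_eval₂, (Ideal.Quotient.eq).mpr hcong, ← IsLocalRing.map_maximalIdeal_of_surjective (Ideal.Quotient.mk I)
    Ideal.Quotient.mk_surjective, ← Ideal.map_pow]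
  exact Ideal.mem_map_of_mem _ ha

/-- **Order additivity** (Zariski–Samuel; tree `mul_not_mem_pow_of_not_mem_pow`): `X ∉ 𝔪²`, `X·a ∈ 𝔪^(k+1)` ⇒ `a ∈ 𝔪^k`.
[cite: ZariskiSamuel1960, Ch. VIII §1 Thm. 1] -/
theorem mem_pow_of_exc_mul_mem {R : Type*} [CommRing R] [IsRegularLocalRing R] {x : R} (hx2 : x ∉ maximalIdeal R ^ 2) {a : R} {k : ℕ}
    (hxa : x * a ∈ maximalIdeal R ^ (k + 1)) : a ∈ maximalIdeal R ^ k := by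
  rcases k with _ | k
  · simp
  by_contra ha
  exact mul_not_mem_pow_of_not_mem_pow (p := 1) (q := k) hx2 ha (by simpa [add_comm, add_assoc] using hxa)

/-- A derivation mapping `S₁` into `(X)` maps `I²` into `(X)·I`, for any ideal `I`. [folklore] -/
theorem apply_sq_mem_of_forall_mem_span (E₁ : Derivation ℤ S₁ S₁) {X₁ : S₁} (hE : ∀ w : S₁, E₁ w ∈ Ideal.span {X₁}) (I : Ideal S₁)
    {ρ : S₁} (hρ : ρ ∈ I ^ 2) : E₁ ρ ∈ Ideal.span {X₁} * I := by
  rw [pow_two] at hρ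
  refine Submodule.mul_induction_on hρ (fun y hy y' hy' => ?_) (fun u v hu hv => ?_)
  · rw [E₁.leibniz, smul_eq_mul, smul_eq_mul]
    exact Ideal.add_mem _ (Submodule.mul_mem_mul_rev (hE y') hy) (Submodule.mul_mem_mul_rev (hE y) hy')
  · rw [map_add]; exact Ideal.add_mem _ hu hv

/-- **Frobenius additivity bookkeeping**: with `s i = 0` for odd `i`,
`Σ ι(cᵢ) tⁱ − (Σ ι(sᵢ) t^{i/2})² = Σ ι(cᵢ − sᵢ²) tⁱ` in characteristic `2`. [folklore] -/
theorem sum_sub_sq_sum_eq [CharP L 2] (ι : S₀ →+* S₁) (t₁ : S₁) (n : ℕ) (c s : ℕ → S₀) (hs : ∀ i, ¬ Even i → s i = 0) :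
    (∑ i ∈ Finset.range n, ι (c i) * t₁ ^ i) - (∑ i ∈ Finset.range n, ι (s i) * t₁ ^ (i / 2)) ^ 2 =
      ∑ i ∈ Finset.range n, ι (c i - s i ^ 2) * t₁ ^ i := by
  have hsq : (∑ i ∈ Finset.range n, ι (s i) * t₁ ^ (i / 2)) ^ 2 = ∑ i ∈ Finset.range n, ι (s i ^ 2) * t₁ ^ i := by
    rw [← frobenius_def, map_sum]
    refine Finset.sum_congr rfl fun i _ => ?_
    rw [frobenius_def, mul_pow, ← map_pow, ← pow_mul]
    by_cases hi : Even i
    · rw [Nat.div_mul_cancel (even_iff_two_dvd.mp hi)]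
    · rw [hs i hi]; simp
  rw [hsq, ← Finset.sum_sub_distrib]
  refine Finset.sum_congr rfl fun i _ => ?_
  rw [map_sub, map_pow, sub_mul]

/-- The polynomial `G_E = Σ (aᵢ + bᵢ T) Tⁱ` (`i < n`): its value at `t` and its degree `≤ n`. [folklore] -/
theorem eval₂_sum_linear_mul_pow (ι : S₀ →+* S₁) (t₁ : S₁) (n : ℕ) (a b : ℕ → S₀) :
    (∑ i ∈ Finset.range n, (Polynomial.C (a i) + Polynomial.C (b i) * Polynomial.X) * Polynomial.X ^ i).eval₂ ι t₁ =
      ∑ i ∈ Finset.range n, (ι (a i) + ι (b i) * t₁) * t₁ ^ i := by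
  rw [Polynomial.eval₂_finsetSum]
  refine Finset.sum_congr rfl fun i _ => ?_
  simp [Polynomial.eval₂_add, Polynomial.eval₂_mul]

/-- Degree bound for `G_E`. [folklore] -/
theorem degree_sum_linear_mul_pow_lt [Nontrivial S₀] (n : ℕ) (a b : ℕ → S₀) {M : ℕ} (hM : n < M) :
    (∑ i ∈ Finset.range n, (Polynomial.C (a i) + Polynomial.C (b i) * Polynomial.X) * Polynomial.X ^ i).degree < (M : WithBot ℕ) := by
  refine (Polynomial.degree_sum_le _ _).trans_lt ?_
  refine (Finset.sup_lt_iff (WithBot.bot_lt_coe M)).mpr fun i hi => ?_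
  have hi' : i < n := Finset.mem_range.mp hi
  calc ((Polynomial.C (a i) + Polynomial.C (b i) * Polynomial.X) * Polynomial.X ^ i).degree
      ≤ (Polynomial.C (a i) + Polynomial.C (b i) * Polynomial.X).degree + (Polynomial.X ^ i : Polynomial S₀).degree :=
        Polynomial.degree_mul_le _ _
    _ ≤ (1 : WithBot ℕ) + (i : WithBot ℕ) := by
        gcongr
        · refine (Polynomial.degree_add_le _ _).trans (max_le ?_ ?_)
          · exact Polynomial.degree_C_le.trans (by exact_mod_cast Nat.zero_le 1)
          · exact (Polynomial.degree_C_mul_X_le _)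
        · rw [Polynomial.degree_X_pow]
    _ < (M : WithBot ℕ) := by
        rw [← Nat.cast_one, ← Nat.cast_add]
        exact_mod_cast (show 1 + i < M by omega)

/-- Exponent bookkeeping: a monomial of degree `n + 1` with `m 2 = 1` is `(n − m 1, m 1, 1)`. [folklore] -/
theorem eq_layer_add_single_two {m : Fin 3 →₀ ℕ} {n : ℕ} (h2 : m 2 = 1) (hdeg : m.degree = n + 1) :
    m = Finsupp.single (0 : Fin 3) (n - m 1) + Finsupp.single 1 (m 1) + Finsupp.single 2 1 := by
  rw [Finsupp.degree_eq_sum, Fin.sum_univ_three, h2] at hdeg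
  ext i
  fin_cases i <;> simp <;> omega

/-- Exponent bookkeeping: `(n − j, j, 0) + (0, 1, 0) = ((n+1) − (j+1), j + 1, 0)`. [folklore] -/
theorem layer_add_single_one (n j : ℕ) :
    Finsupp.single (0 : Fin 3) (n - j) + Finsupp.single 1 j + Finsupp.single 1 1 =
      Finsupp.single (0 : Fin 3) (n + 1 - (j + 1)) + Finsupp.single 1 (j + 1) := by
  rw [add_assoc, ← Finsupp.single_add, Nat.add_sub_add_right]

end Summit.ResolutionOfSingularities.ResolutionOfSingularities.Theorems.SwitchingDichotomy.LemmaI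

end
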